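import Literature.Geometry.Lorentzian.KerrSchildMultiplierEnergyIdentity
import Literature.Geometry.Lorentzian.KerrSchildMultiplierDEC
import HarnessLib

/-!
# Cut-off multipliers `fX`: the bulk `K^{fX} = f K^X + J^X(df)`, the energy identity with a
# smeared boundary, and the sign of the boundary layer term

(family `gr`; infrastructure for the physical-space multiplier estimates behind statement
**gr.S24** — Dafermos–Rodnianski–Shlapentokh-Rothman, arXiv:1402.7034, §2.3.2 and §4 — in the
coefficient-field framework of `KerrSchild.waveOperator`; namespace
`Literature.Geometry.Lorentzian.KerrSchild`)

Dafermos–Rodnianski–Shlapentokh-Rothman (arXiv:1402.7034 = Ann. of Math. 183 (2016)) apply the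
energy identity (ingeneralform2) of §2.3.2 on the region `𝓡(0, τ)` bounded by `Σ_0`, `Σ_τ` and the
event horizon `𝓗⁺`, where the horizon flux `∫_{𝓗⁺} J^N_μ n^μ_{𝓗⁺} ≥ 0` of the (future timelike)
red-shift multiplier `N` has a sign and is simply dropped in upper bounds (§4.5, Prop. 4.5.2;
Remark 2.3.1: "inhomogeneous terms will arise from applying cutoffs"). In the Kerr–Schild chart,
where hypersurfaces are graphs over all of `E3` (`KerrSchildGraphDivergence.lean`), the same effect
is obtained without any boundary integral by *smearing* the inner boundary: replace `N` by the
cut-off multiplier `χN` with `χ = χ(r)` vanishing for `r ≤ r₀ < r₊` and increasing outwards. The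
current of `χN` is `χ J^N` (`KerrSchild.multiplierCurrent_smul`), and its bulk is
`K^{χN} = χ K^N + J^N(dχ)`; the layer term `J^N(dχ) = ∑_μ (J^N)^μ ∂_μχ` has a sign by the
dominant energy condition whenever `dχ` is causal and suitably co-oriented (inside the black hole
`dr` is timelike). This file records these facts for a general `C¹` cut-off `f`:

* `KerrSchild.sum_multiplierCurrent_mul_fderiv` — `∑_μ (J^X)^μ ∂_μ f = (∑_μ A^μ ∂_μf) X(w) − ½ X(f) Q`;
* `KerrSchild.multiplierBulk_smul_eq` — **`K^{fX} = f K^X + ∑_μ (J^X)^μ ∂_μ f`**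
  (`= f K^X + T(X, ∇f)`; from `KerrSchild.multiplierBulk_smul`);
* `KerrSchild.sum_fderiv_multiplierCurrent_smul` — the divergence of the cut-off current,
  `∑_μ ∂_μ (f J^X)^μ = f ((□_G w) X(w) + K^X) + ∑_μ (J^X)^μ ∂_μ f`;
* `KerrSchild.cutoffCurrent_graph_identity` — the energy identity between two graph hypersurfaces
  for `fX` with this bulk (from `KerrSchild.multiplierCurrent_graph_identity`): the **energy identity
  with a smeared boundary**;
* the **sign of the layer term**: if `X(x) = ξ♯` is timelike (`G(ξ, ξ) < 0`, `G ≥ 0` on `ξ^⊥`)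
  and `df(x)` is causal, `G(df, df) ≤ 0`, then `∑_μ (J^X)^μ ∂_μf ≥ 0` when `X(f) = G(ξ, df) < 0` —
  this is literally `KerrSchild.sum_multiplierCurrent_mul_nonneg` (`KerrSchildMultiplierDEC.lean`)
  with `ν = df(x)`, and is not restated here — and `≤ 0` when `X(f) > 0`
  (`KerrSchild.sum_multiplierCurrent_mul_fderiv_nonpos`, from
  `KerrSchild.neg_sum_multiplierCurrent_mul_nonneg`); `KerrSchild.sum_mul_fderiv_eq_toBilin'`
  identifies `X(f) = ∑_μ X^μ ∂_μ f` with `G(ξ, df)`.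

## References

* M. Dafermos, I. Rodnianski, Y. Shlapentokh-Rothman, arXiv:1402.7034 = Ann. of Math. 183 (2016),
  §2.3.2 ((ingeneralform2), the horizon flux), Remark 2.3.1 (cutoffs), §4.5
  (key `DafermosRodnianskiShlapentokhrothman2014`).
* M. Dafermos, I. Rodnianski, arXiv:0811.0354, App. D (key `DafermosRodnianski2008`).
-/

noncomputable section

open Set Filter
open scoped ContDiff Topology

namespace Literature.Geometry.Lorentzian

open _root_.MeasureTheory Metric

namespace KerrSchild

/-! ### Pointwise algebra of cut-off multipliers -/

/-- **The current contracted with a differential**: `∑_μ (J^X)^μ ∂_μ f = (∑_μ A^μ ∂_μ f) X(w) −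
½ X(f) Q` with `A^μ = ∑_ν G^{μν} ∂_νw`, `X(w) = ∑_α X^α∂_αw`, `X(f) = ∑_μ X^μ ∂_μ f`,
`Q = ∑ G^{αβ}∂_αw∂_βw` (i.e. `J^X(df) = T(∇f, X)`). [folklore] -/
theorem sum_multiplierCurrent_mul_fderiv (G : E4 → Fin 4 → Fin 4 → ℝ) (X : E4 → Fin 4 → ℝ)
    (w f : E4 → ℝ) (x : E4) :
    ∑ μ, multiplierCurrent G X w x μ * fderiv ℝ f x (E4.basisVector μ) =
      (∑ μ, (∑ ν, G x μ ν * fderiv ℝ w x (E4.basisVector ν)) *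
          fderiv ℝ f x (E4.basisVector μ)) * (∑ α, X x α * fderiv ℝ w x (E4.basisVector α)) -
        2⁻¹ * (∑ μ, X x μ * fderiv ℝ f x (E4.basisVector μ)) *
          ∑ α, ∑ β, G x α β * fderiv ℝ w x (E4.basisVector α) * fderiv ℝ w x (E4.basisVector β) := by
  -- name the atoms and expand the finite sums
  obtain ⟨p, hp⟩ : ∃ p : Fin 4 → ℝ, ∀ κ, fderiv ℝ w x (E4.basisVector κ) = p κ := ⟨_, fun _ ↦ rfl⟩
  obtain ⟨q, hq⟩ : ∃ q : Fin 4 → ℝ, ∀ κ, fderiv ℝ f x (E4.basisVector κ) = q κ := ⟨_, fun _ ↦ rfl⟩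
  simp only [multiplierCurrent, hp, hq]
  simp only [Fin.sum_univ_four, Fin.isValue]
  ring

/-- **The bulk of a cut-off multiplier**: for `f` and `X` differentiable at `x`,
`K^{fX} = f K^X + ∑_μ (J^X)^μ ∂_μ f` (`= f K^X + T(X, ∇f)`; DRSR arXiv:1402.7034, Remark 2.3.1:
the inhomogeneous terms produced by cutoffs). [cite: DafermosRodnianskiShlapentokhrothman2014, §2.3.1] -/
theorem multiplierBulk_smul_eq (G : E4 → Fin 4 → Fin 4 → ℝ) {f : E4 → ℝ} {X : E4 → Fin 4 → ℝ}
    (w : E4 → ℝ) {x : E4} (hf : DifferentiableAt ℝ f x)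
    (hX : ∀ α, DifferentiableAt ℝ (fun y ↦ X y α) x) :
    multiplierBulk G (fun y α ↦ f y * X y α) w x =
      f x * multiplierBulk G X w x +
        ∑ μ, multiplierCurrent G X w x μ * fderiv ℝ f x (E4.basisVector μ) := by
  rw [multiplierBulk_smul G w hf hX, sum_multiplierCurrent_mul_fderiv]
  ring

/-- **The divergence of a cut-off current**: for `G` differentiable and symmetric at `x`, `f` and
`X` differentiable at `x`, and `w` of class `C²` at `x`,
`∑_μ ∂_μ (f J^X)^μ = f ((□_G w) X(w) + K^X) + ∑_μ (J^X)^μ ∂_μ f`.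
[cite: DafermosRodnianskiShlapentokhrothman2014, §2.3.2] -/
theorem sum_fderiv_multiplierCurrent_smul {G : E4 → Fin 4 → Fin 4 → ℝ} {f : E4 → ℝ}
    {X : E4 → Fin 4 → ℝ} {w : E4 → ℝ} {x : E4}
    (hG : ∀ μ ν, DifferentiableAt ℝ (fun y ↦ G y μ ν) x) (hsymm : ∀ μ ν, G x μ ν = G x ν μ)
    (hf : DifferentiableAt ℝ f x) (hX : ∀ α, DifferentiableAt ℝ (fun y ↦ X y α) x)
    (hw : ContDiffAt ℝ 2 w x) :
    ∑ μ, fderiv ℝ (fun y ↦ multiplierCurrent G (fun z α ↦ f z * X z α) w y μ) x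
        (E4.basisVector μ) =
      f x * (waveOperator G w x * (∑ α, X x α * fderiv ℝ w x (E4.basisVector α)) +
          multiplierBulk G X w x) +
        ∑ μ, multiplierCurrent G X w x μ * fderiv ℝ f x (E4.basisVector μ) := by
  have hfX : ∀ α, DifferentiableAt ℝ (fun y ↦ f y * X y α) x := fun α ↦ hf.mul (hX α)
  rw [sum_fderiv_multiplierCurrent hG hsymm hfX hw, multiplierBulk_smul_eq G w hf hX]
  simp only [mul_assoc, ← Finset.mul_sum]
  ring

/-- The current of a cut-off multiplier is the cut-off current: `(J^{fX})^μ = f (J^X)^μ`, as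
functions. [folklore] -/
theorem multiplierCurrent_smul_fun (G : E4 → Fin 4 → Fin 4 → ℝ) (f : E4 → ℝ)
    (X : E4 → Fin 4 → ℝ) (w : E4 → ℝ) (μ : Fin 4) :
    (fun x ↦ multiplierCurrent G (fun y α ↦ f y * X y α) w x μ) =
      fun x ↦ f x * multiplierCurrent G X w x μ :=
  funext fun x ↦ multiplierCurrent_smul G f X w x μ

/-! ### The energy identity with a smeared boundary -/

/-- **The energy identity between two graph hypersurfaces for a cut-off multiplier `fX`**
(DRSR arXiv:1402.7034, §2.3.2 with the lateral boundary replaced by a cut-off layer). Let `G` be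
a `C¹` symmetric coefficient field, `X` a `C¹` multiplier, `f` a `C¹` function, `F₁ ≤ F₂` two `C²`
heights, `τ ∈ ℝ`, and `w ∈ C²(ℝ⁴)` with `dw = 0` on the far part `{‖y‖ > ρ}` of the closed wedge
between the graphs of `τ + F₁`, `τ + F₂`. Then, with `n^F = dt − dF`,
`∫ f ∑_μ (J^X)^μ n^{F₂}_μ (τ + F₂(y), y) dy − ∫ f ∑_μ (J^X)^μ n^{F₁}_μ (τ + F₁(y), y) dy
  = ∫ ∫_{(τ + F₁(y), τ + F₂(y)]} ( f ((□_G w) X(w) + K^X) + ∑_μ (J^X)^μ ∂_μ f )(t, y) dt dy`.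
When `f` vanishes on an inner region (e.g. `f = χ(r)`, `χ = 0` for `r ≤ r₀`) all integrands vanish
there, and the layer term `∑_μ (J^X)^μ ∂_μ f`, supported where `df ≠ 0`, carries the would-be
boundary flux; its sign is `KerrSchild.sum_multiplierCurrent_mul_nonneg` (with `ν = df`, when
`X(f) < 0`) resp. `sum_multiplierCurrent_mul_fderiv_nonpos` below (when `X(f) > 0`).
[cite: DafermosRodnianskiShlapentokhrothman2014, §2.3.2] -/
theorem cutoffCurrent_graph_identity {G : E4 → Fin 4 → Fin 4 → ℝ} {X : E4 → Fin 4 → ℝ}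
    {f w : E4 → ℝ} (hG : ∀ μ ν, ContDiff ℝ 1 fun x ↦ G x μ ν) (hsymm : ∀ x μ ν, G x μ ν = G x ν μ)
    (hX : ∀ α, ContDiff ℝ 1 fun x ↦ X x α) (hf : ContDiff ℝ 1 f) (hw : ContDiff ℝ 2 w)
    {F₁ F₂ : E3 → ℝ} (hF₁ : ContDiff ℝ 2 F₁) (hF₂ : ContDiff ℝ 2 F₂) (hle : ∀ y, F₁ y ≤ F₂ y)
    {τ ρ : ℝ}
    (hfar : ∀ x : E4, ρ < E4.spatialNorm x → τ + F₁ (E4.spatial x) ≤ x 0 →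
      x 0 ≤ τ + F₂ (E4.spatial x) → fderiv ℝ w x = 0) :
    (∫ y, f (E4.ofTimeSpace (τ + F₂ y) y) *
        ∑ μ, multiplierCurrent G X w (E4.ofTimeSpace (τ + F₂ y) y) μ * Kerr.graphConormal F₂ y μ) -
        ∫ y, f (E4.ofTimeSpace (τ + F₁ y) y) *
          ∑ μ, multiplierCurrent G X w (E4.ofTimeSpace (τ + F₁ y) y) μ *
            Kerr.graphConormal F₁ y μ =
      ∫ y, ∫ t in Set.Ioc (τ + F₁ y) (τ + F₂ y),
        (f (E4.ofTimeSpace t y) *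
            (waveOperator G w (E4.ofTimeSpace t y) *
                (∑ α, X (E4.ofTimeSpace t y) α *
                  fderiv ℝ w (E4.ofTimeSpace t y) (E4.basisVector α)) +
              multiplierBulk G X w (E4.ofTimeSpace t y)) +
          ∑ μ, multiplierCurrent G X w (E4.ofTimeSpace t y) μ *
            fderiv ℝ f (E4.ofTimeSpace t y) (E4.basisVector μ)) := by
  have hfX : ∀ α, ContDiff ℝ 1 fun x ↦ f x * X x α := fun α ↦ hf.mul (hX α)
  have h := multiplierCurrent_graph_identity (X := fun y α ↦ f y * X y α) hG hsymm hfX hw hF₁ hF₂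
    hle hfar (τ := τ) (ρ := ρ)
  -- the fluxes: `(J^{fX})^μ = f (J^X)^μ`
  have hflux : ∀ (F : E3 → ℝ) (y : E3) (t : ℝ),
      ∑ μ, multiplierCurrent G (fun y α ↦ f y * X y α) w (E4.ofTimeSpace t y) μ *
          Kerr.graphConormal F y μ =
        f (E4.ofTimeSpace t y) *
          ∑ μ, multiplierCurrent G X w (E4.ofTimeSpace t y) μ * Kerr.graphConormal F y μ := by
    intro F y t
    rw [Finset.mul_sum]
    exact Finset.sum_congr rfl fun μ _ ↦ by rw [multiplierCurrent_smul]; ring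
  simp only [hflux] at h
  rw [h]
  -- the bulk: `(fX)(w) = f X(w)` and `K^{fX} = f K^X + J^X(df)`
  refine congrArg (fun g : E3 → ℝ ↦ ∫ y, g y) (funext fun y ↦ ?_)
  refine setIntegral_congr_fun measurableSet_Ioc fun t _ ↦ ?_
  have hfd : DifferentiableAt ℝ f (E4.ofTimeSpace t y) := (hf.differentiable one_ne_zero).differentiableAt
  have hXd : ∀ α, DifferentiableAt ℝ (fun x ↦ X x α) (E4.ofTimeSpace t y) := fun α ↦
    ((hX α).differentiable one_ne_zero).differentiableAt
  simp only [multiplierBulk_smul_eq G w hfd hXd, mul_assoc, ← Finset.mul_sum]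
  ring

/-! ### The sign of the layer term -/

/-- **The layer term has a sign (dominant energy condition).** If at `x` the multiplier is the
metric dual of a timelike covector, `X^α(x) = ∑_β G^{αβ}(x) ξ_β`, `G(ξ, ξ) < 0`, `G(x) ≥ 0` on
`ξ^⊥`, and the differential of the cut-off is causal, `G(df, df) ≤ 0`, with `X(f) = G(ξ, df) > 0`
(the cut-off decreases along `X`), then `∑_μ (J^X)^μ(x) ∂_μ f(x) ≤ 0`. The co-oriented case
`X(f) < 0 ⟹ 0 ≤ ∑_μ (J^X)^μ ∂_μ f` is `KerrSchild.sum_multiplierCurrent_mul_nonneg`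
(`KerrSchildMultiplierDEC.lean`) applied to `ν = df(x)` and is not restated. (For the smeared inner
boundary of a black hole: `f = χ(r)` with `χ' ≥ 0`, where `dr` is timelike inside the horizon.)
[cite: DafermosRodnianskiShlapentokhrothman2014, §2.3.2] -/
theorem sum_multiplierCurrent_mul_fderiv_nonpos {G : E4 → Fin 4 → Fin 4 → ℝ} {X : E4 → Fin 4 → ℝ}
    (w f : E4 → ℝ) {x : E4} (hsymm : ∀ μ ν, G x μ ν = G x ν μ) {ξ : Fin 4 → ℝ}
    (hX : ∀ α, X x α = ∑ β, G x α β * ξ β) (hξ : Matrix.toBilin' (G x) ξ ξ < 0)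
    (hsig : ∀ u, Matrix.toBilin' (G x) ξ u = 0 → 0 ≤ Matrix.toBilin' (G x) u u)
    (hcausal : Matrix.toBilin' (G x) (fun κ ↦ fderiv ℝ f x (E4.basisVector κ))
      (fun κ ↦ fderiv ℝ f x (E4.basisVector κ)) ≤ 0)
    (hco : 0 < Matrix.toBilin' (G x) ξ (fun κ ↦ fderiv ℝ f x (E4.basisVector κ))) :
    ∑ μ, multiplierCurrent G X w x μ * fderiv ℝ f x (E4.basisVector μ) ≤ 0 := by
  have h := neg_sum_multiplierCurrent_mul_nonneg w hsymm hX hξ hsig hcausal hco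
  linarith

/-- **`X(f)` in terms of the covector**: if `X^α(x) = ∑_β G^{αβ}(x) ξ_β` with `G` symmetric at `x`,
then `X(f)(x) = ∑_μ X^μ ∂_μ f = G(ξ, df)`, so the co-orientation hypotheses above are conditions on
the sign of the derivative of the cut-off along the multiplier. [folklore] -/
theorem sum_mul_fderiv_eq_toBilin' {G : E4 → Fin 4 → Fin 4 → ℝ} {X : E4 → Fin 4 → ℝ} (f : E4 → ℝ)
    {x : E4} (hsymm : ∀ μ ν, G x μ ν = G x ν μ) {ξ : Fin 4 → ℝ}
    (hX : ∀ α, X x α = ∑ β, G x α β * ξ β) :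
    ∑ μ, X x μ * fderiv ℝ f x (E4.basisVector μ) =
      Matrix.toBilin' (G x) ξ (fun κ ↦ fderiv ℝ f x (E4.basisVector κ)) := by
  simp only [Matrix.toBilin'_apply, hX, Finset.sum_mul]
  rw [Finset.sum_comm]
  refine Finset.sum_congr rfl fun i _ ↦ Finset.sum_congr rfl fun j _ ↦ ?_
  rw [hsymm j i]
  ring

end KerrSchild

end Literature.Geometry.Lorentzian
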